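import Literature.MathematicalPhysics.QuantumFieldTheory.Balaban1983to89.B6TorusSiteWalks

/-!
# `Balaban1983to89.B6TorusGeodesicWalks` — COORDINATE STAIRCASE WALKS ON THE TORUS LATTICE `Π_μ ℤ∕N_μ` that stay in the torus sup-ball of their endpoints:
# for two sites `t, z` a lattice walk `t ⇝ z` of length `≤ Σ_μ dist_T(z_μ, t_μ) ≤ (d+1)·|z − t|_T` all of whose sites `v` obey `|v − t|_T ≤ |z − t|_T`; and the
# weighted length of a walk through sites of level `≥ J` is at most `(L^J)⁻¹ ×` its length

[4] = T. Bałaban, *Propagators and renormalization transformations for lattice gauge theories. II*, Commun. Math. Phys. **96** (1984) 223–250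
[`Balaban1984PropagatorsII`]; [3] = T. Bałaban, *Regularity and decay of lattice Green's functions*, Commun. Math. Phys. **89** (1983) 571–597
[`Balaban1983RegularityDecay`].

statement-level skeleton of published theorems with citation tags; proofs where landed; nothing here is a claim about the
Yang–Mills mass gap

THE PRINTED LOCI.  [4] (2.46) p. 231: the block distance `d(y, y′)` along admissible contours, p. 231–232: *"d(x, x′) = d(y, y′) if x ∈ B^j(y)"*, (2.1)–(2.2)
p. 224 (the torus `Ω₁ = T_η`, the level sets); [3] p. 572 (periodic conditions).  The sequel `B6AgmonExponentMultiLevelTorus.distT_blkOf_le_of_walk` bounds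
`d_T(y(z), y(z′))` by `2L·W(γ) + 1` for ANY lattice walk `γ`; THIS FILE supplies the walk: a coordinate staircase inside the torus sup-ball, whose weighted length is
controlled as soon as the ball lies in a level band.

WHY THIS FILE (cell `pub-ymgap`, node N06, width seat `pub-ymgap-dag-n06-w6` g2; LAYER B of the enlargement adapter for the smooth-partition class: dag-n06-l g20's
neighbourhoods `NearY` are torus-metric balls, the producers' kernels decay in the block distance `d_T` — the bridge is «sites within `C·L^j` of a level-`j` block
have blocks within `O(1)` of it in `d_T`», by a staircase walk in the two-level band of [4] (2.2)).
* §1 the forward run `run e μ m = σ_{m·e_μ} e` and its coordinates; ★ `exists_fwdWalk` (a lattice walk `e ⇝ run e μ n` of length `≤ n` through the run);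
* §2 ★ `exists_coordWalk` (one coordinate, shorter arc: length `≤ dist_T` of that coordinate, the coordinate distance to `t` never exceeds the target's);
  ★★ `exists_stairWalk` ∕ `exists_ballWalk` (all coordinates: a walk `t ⇝ z` with `length ≤ (d+1)·|z − t|_T` and `|v − t|_T ≤ |z − t|_T` along it);
* §3 ★ `wtLen_le_length_mul` (`W(γ) ≤ |γ|·(L^J)⁻¹` if every site of `γ` has level `≥ J`).
HONEST SCOPE.  Elementary torus-lattice combinatorics; nothing of [4] asserted; COUNT-NEUTRAL; nothing continuum, nothing about the mass gap.  Cell `pub-ymgap`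
(HUMAN RULING D-0062), Track A node N06 [B9], width seat `pub-ymgap-dag-n06-w6` (g2), 2026-08-28.
-/

noncomputable section

namespace Literature.MathematicalPhysics.QuantumFieldTheory.Balaban1983to89.B6TorusGeodesicWalks

open Literature.MathematicalPhysics.QuantumFieldTheory.Balaban1983to89.B4Reflection242 (boxDom mem_boxDom)
open Literature.MathematicalPhysics.QuantumFieldTheory.Balaban1983to89.B4TorusKernel.MultiPeriod (circAbs circAbs_nonneg circAbs_le_abs circAbs_add_mul
  torusSupNorm torusSupNorm_nonneg emod_nonneg_of_one_le emod_lt_of_one_le two_mul_circAbs_le)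
open Literature.MathematicalPhysics.QuantumFieldTheory.Balaban1983to89.B6MultiLevelBoxOperator
open Literature.MathematicalPhysics.QuantumFieldTheory.Balaban1983to89.B6MultiLevelTorusOperator
open Literature.MathematicalPhysics.QuantumFieldTheory.Balaban1983to89.B6TorusSiteWalks

variable {d : ℕ} {N : Fin (d + 1) → ℕ}

/-! ## §1 The forward run along one coordinate and its lattice walk -/

/-- the `m`-th point of the forward run from `e` in direction `μ`: `σ_{m·e_μ} e`. [cite: Balaban1983RegularityDecay, p.572 (periodic conditions), dictionary] -/
def run (e : ↥(boxDom N)) (μ : Fin (d + 1)) (m : ℕ) : ↥(boxDom N) := tshift N ((m : ℤ) • unitVec μ) e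

/-- `run e μ 0 = e`. [cite: Balaban1983RegularityDecay, p.572, bookkeeping] -/
theorem run_zero (e : ↥(boxDom N)) (μ : Fin (d + 1)) : run e μ 0 = e := by
  unfold run; rw [Nat.cast_zero, zero_smul, tshift_zero]

/-- `run e μ (m+1) = σ_{e_μ} (run e μ m)`. [cite: Balaban1983RegularityDecay, p.572, bookkeeping] -/
theorem run_succ (e : ↥(boxDom N)) (μ : Fin (d + 1)) (m : ℕ) : run e μ (m + 1) = tshift N (unitVec μ) (run e μ m) := by
  unfold run; rw [tshift_tshift, Nat.cast_succ, add_smul, one_smul]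

/-- the coordinates of the run: `(run e μ m)_ν = (e_ν + m·[ν = μ]) mod N_ν`. [cite: Balaban1983RegularityDecay, p.572, bookkeeping] -/
theorem run_apply (e : ↥(boxDom N)) (μ : Fin (d + 1)) (m : ℕ) (ν : Fin (d + 1)) :
    (run e μ m).1 ν = (e.1 ν + (if ν = μ then (m : ℤ) else 0)) % (N ν : ℤ) := by
  unfold run
  rw [tshift_val]
  simp only [twrap, Pi.add_apply, Pi.smul_apply, unitVec, smul_eq_mul]
  by_cases h : ν = μ
  · subst h; simp
  · simp [h]

/-- off the direction the run does not move: `(run e μ m)_ν = e_ν` for `ν ≠ μ`. [cite: Balaban1983RegularityDecay, p.572, bookkeeping] -/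
theorem run_apply_ne (e : ↥(boxDom N)) {μ ν : Fin (d + 1)} (h : ν ≠ μ) (m : ℕ) : (run e μ m).1 ν = e.1 ν := by
  rw [run_apply, if_neg h, add_zero]
  have he := (mem_boxDom.1 e.2) ν
  exact Int.emod_eq_of_lt he.1 he.2

/-- in the direction: `(run e μ m)_μ = (e_μ + m) mod N_μ`. [cite: Balaban1983RegularityDecay, p.572, bookkeeping] -/
theorem run_apply_self (e : ↥(boxDom N)) (μ : Fin (d + 1)) (m : ℕ) : (run e μ m).1 μ = (e.1 μ + m) % (N μ : ℤ) := by
  rw [run_apply, if_pos rfl]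

/-- ★ a lattice walk along the run: from `e` to `run e μ n`, of length `≤ n`, visiting only run points `run e μ m`, `m ≤ n`.
[cite: Balaban1983RegularityDecay, p.572 (periodic conditions); Balaban1984PropagatorsII, (2.46) p.231, dictionary] -/
theorem exists_fwdWalk (e : ↥(boxDom N)) (μ : Fin (d + 1)) (n : ℕ) :
    ∃ p : (latGraphT N).Walk e (run e μ n), p.length ≤ n ∧ ∀ v ∈ p.support, ∃ m, m ≤ n ∧ v = run e μ m := by
  induction n with
  | zero =>
      refine ⟨(SimpleGraph.Walk.nil : (latGraphT N).Walk e e).copy rfl (run_zero e μ).symm, by simp, fun v hv => ⟨0, le_rfl, ?_⟩⟩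
      simp only [SimpleGraph.Walk.support_copy, SimpleGraph.Walk.support_nil, List.mem_singleton] at hv
      rw [hv, run_zero]
  | succ n ih =>
      obtain ⟨p, hlen, hsup⟩ := ih
      by_cases h : run e μ n = run e μ (n + 1)
      · refine ⟨p.copy rfl h, by simpa using hlen.trans (Nat.le_succ n), fun v hv => ?_⟩
        rw [SimpleGraph.Walk.support_copy] at hv
        obtain ⟨m, hm, hv⟩ := hsup v hv
        exact ⟨m, hm.trans (Nat.le_succ n), hv⟩
      · have hadj : (latGraphT N).Adj (run e μ n) (run e μ (n + 1)) := latGraphT_adj.2 ⟨h, Or.inl ⟨μ, run_succ e μ n⟩⟩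
        refine ⟨p.concat hadj, by rw [SimpleGraph.Walk.length_concat]; omega, fun v hv => ?_⟩
        rw [SimpleGraph.Walk.support_concat, List.mem_append, List.mem_singleton] at hv
        rcases hv with hv | hv
        · obtain ⟨m, hm, hv⟩ := hsup v hv
          exact ⟨m, hm.trans (Nat.le_succ n), hv⟩
        · exact ⟨n + 1, le_rfl, hv⟩

/-! ## §2 One coordinate along the shorter arc; the staircase inside the torus sup-ball -/

/-- arithmetic of the shorter arc, forward case: `circAbs N m ≤ m` for `0 ≤ m`. [cite: Balaban1983RegularityDecay, p.572, bookkeeping] -/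
theorem circAbs_le_self {M : ℕ} (hM : 1 ≤ M) {m : ℤ} (hm : 0 ≤ m) : circAbs M m ≤ m :=
  (circAbs_le_abs hM m).trans (le_of_eq (abs_of_nonneg hm))

/-- the residue `a = x mod N` realises `circAbs` as `min a (N − a)`. [cite: Balaban1983RegularityDecay, p.572, bookkeeping] -/
theorem circAbs_eq_min (M : ℕ) (x : ℤ) : circAbs M x = min (x % (M : ℤ)) ((M : ℤ) - x % (M : ℤ)) := rfl

/-- replacing a coordinate of a box site by the corresponding coordinate of another box site stays in the box.
[cite: Balaban1983RegularityDecay, p.572, bookkeeping] -/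
theorem update_mem (c z : ↥(boxDom N)) (μ : Fin (d + 1)) : Function.update c.1 μ (z.1 μ) ∈ boxDom N := by
  rw [mem_boxDom]; intro i
  by_cases h : i = μ
  · subst h; rw [Function.update_self]; exact (mem_boxDom.1 z.2) i
  · rw [Function.update_of_ne h]; exact (mem_boxDom.1 c.2) i

/-- ★ **ONE COORDINATE ALONG THE SHORTER ARC**: from a site `c` with `c_μ = t_μ` to the site `c′` with `c′_μ = z_μ` (other coordinates kept), by a lattice walk of
length `≤ dist_T(z_μ, t_μ) = circAbs N_μ (z_μ − t_μ)` all of whose sites keep the other coordinates and have `μ`-coordinate within `circAbs N_μ (z_μ − t_μ)` of `t_μ`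
on the circle. [cite: Balaban1983RegularityDecay, p.572 (periodic conditions); Balaban1984PropagatorsII, (2.46) p.231, dictionary] -/
theorem exists_coordWalk (t z c : ↥(boxDom N)) (μ : Fin (d + 1)) (hc : c.1 μ = t.1 μ) :
    ∃ (c' : ↥(boxDom N)) (p : (latGraphT N).Walk c c'), c'.1 μ = z.1 μ ∧ (∀ ν, ν ≠ μ → c'.1 ν = c.1 ν) ∧
      (p.length : ℤ) ≤ circAbs (N μ) (z.1 μ - t.1 μ) ∧
      ∀ v ∈ p.support, (∀ ν, ν ≠ μ → v.1 ν = c.1 ν) ∧ circAbs (N μ) (v.1 μ - t.1 μ) ≤ circAbs (N μ) (z.1 μ - t.1 μ) := by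
  have hN : 1 ≤ N μ := one_le_of_mem c.2 μ
  have hNz : (0 : ℤ) < (N μ : ℤ) := by exact_mod_cast hN
  have ht := (mem_boxDom.1 t.2) μ
  have hz := (mem_boxDom.1 z.2) μ
  set a : ℤ := (z.1 μ - t.1 μ) % (N μ : ℤ) with ha
  have ha0 : 0 ≤ a := emod_nonneg_of_one_le hN _
  have haN : a < N μ := emod_lt_of_one_le hN _
  have hcirc : circAbs (N μ) (z.1 μ - t.1 μ) = min a ((N μ : ℤ) - a) := circAbs_eq_min _ _
  -- the residue identity: z_μ ≡ t_μ + a (mod N), and both sides are box coordinates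
  have hza : (t.1 μ + a) % (N μ : ℤ) = z.1 μ := by
    rw [ha, Int.add_emod, Int.emod_emod_of_dvd _ dvd_rfl, ← Int.add_emod, add_sub_cancel, Int.emod_eq_of_lt hz.1 hz.2]
  by_cases h2 : 2 * a ≤ (N μ : ℤ)
  · -- forward `a` steps from `c`
    obtain ⟨p, hlen, hsup⟩ := exists_fwdWalk c μ a.toNat
    have haa : ((a.toNat : ℕ) : ℤ) = a := Int.toNat_of_nonneg ha0
    refine ⟨run c μ a.toNat, p, ?_, fun ν hν => run_apply_ne c hν _, ?_, fun v hv => ?_⟩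
    · rw [run_apply_self, haa, hc, hza]
    · calc (p.length : ℤ) ≤ ((a.toNat : ℕ) : ℤ) := by exact_mod_cast hlen
        _ = a := haa
        _ = circAbs (N μ) (z.1 μ - t.1 μ) := by rw [hcirc, min_eq_left (by omega)]
    · obtain ⟨m, hm, rfl⟩ := hsup v hv
      refine ⟨fun ν hν => run_apply_ne c hν _, ?_⟩
      have hmz : ((m : ℕ) : ℤ) ≤ a := by rw [← haa]; exact_mod_cast hm
      rw [run_apply_self, hc]
      -- `(t_μ + m) % N − t_μ = m − N·q`
      have hrep : (t.1 μ + m) % (N μ : ℤ) - t.1 μ = (m : ℤ) + (N μ : ℤ) * (-((t.1 μ + m) / (N μ : ℤ))) := by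
        rw [Int.emod_def]; ring
      rw [hrep, circAbs_add_mul, hcirc, min_eq_left (by omega)]
      exact (circAbs_le_self hN (by positivity)).trans hmz
  · -- backward `N − a` steps: forward from `c′` to `c`, reversed
    push Not at h2
    set c' : ↥(boxDom N) := ⟨Function.update c.1 μ (z.1 μ), update_mem c z μ⟩ with hc'def
    have hc'μ : c'.1 μ = z.1 μ := by simp [hc'def]
    have hc'ν : ∀ ν, ν ≠ μ → c'.1 ν = c.1 ν := fun ν hν => by simp [hc'def, Function.update_of_ne hν]
    set n : ℕ := ((N μ : ℤ) - a).toNat with hndef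
    have hnn : ((n : ℕ) : ℤ) = (N μ : ℤ) - a := Int.toNat_of_nonneg (by omega)
    have hrun : run c' μ n = c := by
      apply Subtype.ext; funext ν
      by_cases hν : ν = μ
      · subst hν
        rw [run_apply_self, hc'μ, hnn, hc]
        -- `(z_μ + N − a) % N = t_μ`
        have e1 : z.1 ν + ((N ν : ℤ) - a) = (z.1 ν - a) + (N ν : ℤ) * 1 := by ring
        rw [e1, Int.add_mul_emod_self_left]
        have e2 : (z.1 ν - a) % (N ν : ℤ) = (t.1 ν) % (N ν : ℤ) := by
          rw [ha, Int.sub_emod, Int.emod_emod_of_dvd _ dvd_rfl, ← Int.sub_emod, sub_sub_cancel]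
        rw [e2, Int.emod_eq_of_lt ht.1 ht.2]
      · rw [run_apply_ne c' hν, hc'ν ν hν]
    obtain ⟨p, hlen, hsup⟩ := exists_fwdWalk c' μ n
    refine ⟨c', (p.copy rfl hrun).reverse, hc'μ, hc'ν, ?_, fun v hv => ?_⟩
    · rw [SimpleGraph.Walk.length_reverse, SimpleGraph.Walk.length_copy]
      calc (p.length : ℤ) ≤ ((n : ℕ) : ℤ) := by exact_mod_cast hlen
        _ = (N μ : ℤ) - a := hnn
        _ = circAbs (N μ) (z.1 μ - t.1 μ) := by rw [hcirc, min_eq_right (by omega)]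
    · rw [SimpleGraph.Walk.support_reverse, List.mem_reverse, SimpleGraph.Walk.support_copy] at hv
      obtain ⟨m, hm, rfl⟩ := hsup v hv
      refine ⟨fun ν hν => by rw [run_apply_ne c' hν, hc'ν ν hν], ?_⟩
      have hmn : ((m : ℕ) : ℤ) ≤ (N μ : ℤ) - a := by rw [← hnn]; exact_mod_cast hm
      rw [run_apply_self, hc'μ]
      -- `(z_μ + m) % N − t_μ = (a + m − N) + N·q`
      have hzt : z.1 μ - t.1 μ = a + (N μ : ℤ) * ((z.1 μ - t.1 μ) / (N μ : ℤ)) := by rw [ha, Int.emod_def]; ring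
      have hrep : (z.1 μ + m) % (N μ : ℤ) - t.1 μ =
          (a + m - (N μ : ℤ)) + (N μ : ℤ) * ((z.1 μ - t.1 μ) / (N μ : ℤ) + 1 - (z.1 μ + m) / (N μ : ℤ)) := by
        rw [Int.emod_def]; linear_combination hzt
      rw [hrep, circAbs_add_mul, hcirc, min_eq_right (by omega)]
      calc circAbs (N μ) (a + m - (N μ : ℤ)) ≤ |a + m - (N μ : ℤ)| := circAbs_le_abs hN _
        _ = (N μ : ℤ) - a - m := by rw [abs_of_nonpos (by omega)]; ring
        _ ≤ (N μ : ℤ) - a := by omega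

/-- ★★ **THE COORDINATE STAIRCASE** (induction over a duplicate-free list of directions): from a site `c` agreeing with `t` on the listed coordinates, a lattice walk
to a site agreeing with `z` on them (and with `c` elsewhere), of length `≤ Σ_{μ ∈ l} circAbs N_μ (z_μ − t_μ)`, along which every coordinate stays within
`circAbs N_ν (z_ν − t_ν)` of `t_ν` provided `c` does. [cite: Balaban1984PropagatorsII, (2.46) p.231, p.231–232; Balaban1983RegularityDecay, p.572, dictionary] -/
theorem exists_stairWalk (t z : ↥(boxDom N)) :
    ∀ (l : List (Fin (d + 1))), l.Nodup → ∀ c : ↥(boxDom N), (∀ ν ∈ l, c.1 ν = t.1 ν) →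
      (∀ ν, circAbs (N ν) (c.1 ν - t.1 ν) ≤ circAbs (N ν) (z.1 ν - t.1 ν)) →
      ∃ (c' : ↥(boxDom N)) (p : (latGraphT N).Walk c c'), (∀ ν ∈ l, c'.1 ν = z.1 ν) ∧ (∀ ν, ν ∉ l → c'.1 ν = c.1 ν) ∧
        (p.length : ℤ) ≤ (l.map fun ν => circAbs (N ν) (z.1 ν - t.1 ν)).sum ∧
        ∀ v ∈ p.support, ∀ ν, circAbs (N ν) (v.1 ν - t.1 ν) ≤ circAbs (N ν) (z.1 ν - t.1 ν) := by
  intro l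
  induction l with
  | nil =>
      intro _ c _ hball
      refine ⟨c, SimpleGraph.Walk.nil, fun ν hν => (List.not_mem_nil hν).elim, fun ν _ => rfl, by simp, fun v hv ν => ?_⟩
      rw [SimpleGraph.Walk.support_nil, List.mem_singleton] at hv
      rw [hv]; exact hball ν
  | cons μ l ih =>
      intro hnd c hct hball
      obtain ⟨hμl, hl⟩ := List.nodup_cons.1 hnd
      obtain ⟨c₁, p₁, hc₁μ, hc₁ν, hlen₁, hsup₁⟩ := exists_coordWalk t z c μ (hct μ (List.mem_cons_self))
      have hc₁t : ∀ ν ∈ l, c₁.1 ν = t.1 ν := fun ν hν => by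
        rw [hc₁ν ν (fun h => hμl (h ▸ hν))]; exact hct ν (List.mem_cons_of_mem μ hν)
      have hball₁ : ∀ ν, circAbs (N ν) (c₁.1 ν - t.1 ν) ≤ circAbs (N ν) (z.1 ν - t.1 ν) := fun ν => by
        by_cases h : ν = μ
        · subst h; rw [hc₁μ]
        · rw [hc₁ν ν h]; exact hball ν
      obtain ⟨c', p₂, hc'z, hc'c, hlen₂, hsup₂⟩ := ih hl c₁ hc₁t hball₁
      refine ⟨c', p₁.append p₂, fun ν hν => ?_, fun ν hν => ?_, ?_, fun v hv ν => ?_⟩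
      · rcases List.mem_cons.1 hν with rfl | hν
        · rw [hc'c ν hμl, hc₁μ]
        · exact hc'z ν hν
      · rw [hc'c ν (fun h => hν (List.mem_cons_of_mem μ h)), hc₁ν ν (fun h => hν (h ▸ List.mem_cons_self))]
      · rw [SimpleGraph.Walk.length_append, Nat.cast_add, List.map_cons, List.sum_cons]
        exact add_le_add hlen₁ hlen₂
      · rw [SimpleGraph.Walk.mem_support_append_iff] at hv
        rcases hv with hv | hv
        · obtain ⟨hvν, hvμ⟩ := hsup₁ v hv
          by_cases h : ν = μ
          · subst h; exact hvμ
          · rw [hvν ν h]; exact hball ν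
        · exact hsup₂ v hv ν

/-- the coordinate circular distances sum to at most `(d+1) ×` the torus sup-distance. [cite: Balaban1983RegularityDecay, p.572, bookkeeping] -/
theorem sum_circAbs_le (x : Fin (d + 1) → ℤ) :
    (((∑ ν : Fin (d + 1), circAbs (N ν) (x ν) : ℤ)) : ℝ) ≤ ((d : ℝ) + 1) * torusSupNorm N x := by
  rw [Int.cast_sum]
  calc ∑ ν : Fin (d + 1), ((circAbs (N ν) (x ν) : ℤ) : ℝ) ≤ ∑ _ν : Fin (d + 1), torusSupNorm N x :=
        Finset.sum_le_sum fun ν _ => circAbs_le_torusSupNorm x ν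
    _ = ((d : ℝ) + 1) * torusSupNorm N x := by
        rw [Finset.sum_const, Finset.card_univ, Fintype.card_fin, nsmul_eq_mul, Nat.cast_succ]

/-- coordinatewise domination of circular distances gives domination of the torus sup-distances. [cite: Balaban1983RegularityDecay, p.572, bookkeeping] -/
theorem torusSupNorm_le_of_circAbs_le {x x' : Fin (d + 1) → ℤ} (h : ∀ ν, circAbs (N ν) (x ν) ≤ circAbs (N ν) (x' ν)) :
    torusSupNorm N x ≤ torusSupNorm N x' := by
  unfold torusSupNorm
  refine Finset.sup'_le _ _ fun ν _ => le_trans ?_ (Finset.le_sup' (fun i => ((circAbs (N i) (x' i) : ℤ) : ℝ)) (Finset.mem_univ ν))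
  exact_mod_cast h ν

/-- ★★ **THE STAIRCASE WALK INSIDE THE TORUS SUP-BALL**: for any two sites `t, z` of the torus box there is a lattice walk `t ⇝ z` of length
`≤ (d+1)·|z − t|_T` all of whose sites `v` satisfy `|v − t|_T ≤ |z − t|_T`. [cite: Balaban1984PropagatorsII, (2.46) p.231, p.231–232 («d(x, x′) = d(y, y′) …»); Balaban1983RegularityDecay, p.572, dictionary] -/
theorem exists_ballWalk (t z : ↥(boxDom N)) :
    ∃ p : (latGraphT N).Walk t z, (p.length : ℝ) ≤ ((d : ℝ) + 1) * torusSupNorm N (z.1 - t.1) ∧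
      ∀ v ∈ p.support, torusSupNorm N (v.1 - t.1) ≤ torusSupNorm N (z.1 - t.1) := by
  obtain ⟨c', p, hc'z, -, hlen, hsup⟩ := exists_stairWalk t z (List.finRange (d + 1)) (List.nodup_finRange _) t (fun ν _ => rfl)
    (fun ν => by rw [sub_self, show circAbs (N ν) 0 = 0 from by unfold circAbs; simp]; exact circAbs_nonneg (one_le_of_mem t.2 ν) _)
  have hc' : c' = z := Subtype.ext (funext fun ν => hc'z ν (List.mem_finRange ν))
  subst hc'
  refine ⟨p, ?_, fun v hv => torusSupNorm_le_of_circAbs_le fun ν => by simpa only [Pi.sub_apply] using hsup v hv ν⟩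
  have h1 : (p.length : ℝ) ≤ (((∑ ν : Fin (d + 1), circAbs (N ν) ((c'.1 - t.1) ν) : ℤ)) : ℝ) := by
    have h2 : ((List.finRange (d + 1)).map fun ν => circAbs (N ν) (c'.1 ν - t.1 ν)).sum = ∑ ν : Fin (d + 1), circAbs (N ν) ((c'.1 - t.1) ν) := by
      rw [Fin.sum_univ_def]; rfl
    rw [← h2]; exact_mod_cast hlen
  exact h1.trans (sum_circAbs_le _)

/-! ## §3 The weighted length of a walk through a level band -/

section Weighted

variable {ℓ Mh k R : ℕ} {P : Fin (d + 1) → ℕ} (D : TDomains d ℓ Mh k P R)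

/-- ★ **ABOVE LEVEL `J` EACH STEP WEIGHS AT MOST `(L^J)⁻¹`**: if every site of the walk has level `≥ J` then `W(γ) ≤ |γ|·(L^J)⁻¹` (the converse companion of
`B6TorusSiteWalks.length_le_mul_wtLen`). [cite: Balaban1984PropagatorsII, p.231–232 (d versus (Lʲη)⁻¹|x − x′|), dictionary] -/
theorem wtLen_le_length_mul {J : ℕ} {x y : ↥(boxDom (N0 ℓ Mh k P))} (p : (latGraphT (N0 ℓ Mh k P)).Walk x y)
    (hJ : ∀ z ∈ p.support, J ≤ D.lev z.1) : wtLen D p ≤ (p.length : ℝ) * ((((ℓ + 1) ^ J : ℕ) : ℝ))⁻¹ := by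
  induction p with
  | nil => simp
  | @cons u v w h p ih =>
      rw [wtLen_cons, SimpleGraph.Walk.length_cons, Nat.cast_add, Nat.cast_one, add_mul, one_mul]
      have hu : J ≤ D.lev u.1 := hJ u (by simp)
      have hstep : stepWt D u v ≤ ((((ℓ + 1) ^ J : ℕ) : ℝ))⁻¹ :=
        (stepWt_le_left D u v).trans (inv_anti₀ (by positivity) (by exact_mod_cast Nat.pow_le_pow_right (by omega) hu))
      have ih' := ih (fun z hz => hJ z (by simp [hz]))
      linarith

end Weighted

end Literature.MathematicalPhysics.QuantumFieldTheory.Balaban1983to89.B6TorusGeodesicWalks
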